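import Literature.AlgebraicGeometry.Frobenioids.ArithmeticFrobenioidThm64ivAtData
import Literature.AlgebraicGeometry.Frobenioids.ArithmeticFrobenioidThm64iiiAtData
import Literature.AlgebraicGeometry.Frobenioids.ArithmeticFrobenioidDivisorTransport
import HarnessLib

/-!
# Frobenioids I, Theorem 6.4 (iii)/(iv) — the typed schemas at THE constructions, BINDER-FREE: for every
# equivalence `Ψ : C_{K₁/F₁} ⥲ C_{K₂/F₂}` of arithmetic Frobenioids (row «T64-ASSEMBLIES», companion)

Mochizuki, *The geometry of Frobenioids I: the general theory*, Kyushu J. Math. **62** (2008) 293–400, §6,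
Thm. 6.4 (iii) pp. 114–115 and (iv) p. 115 l. 17–29. [cite: MochizukiFrdI2008, Thm. 6.4 (iv) p.115]

PROOF-ONLY (cell abc-iut; seat abc-iut-L1-t3; 0 `def`).  The Cor. 4.11 (iv) DATUM binders of
`ArithmeticFrobenioidThm64ivAtData.lean` / `ArithmeticFrobenioidThm64iiiAtData.lean` (`Ψ^Base`, `E = Ψ^Φ`, `η`, the
`Div`-clause, `π`, "generator ↦ generator") are DISCHARGED for every `Ψ`: the typed [FrdI] Cor. 4.11 (iv) HOLDS at
`C_{K/F}` — abc-iut-L1-d1's `cor411iv_arith` (`ArithmeticFrobenioidDivisorTransport.lean`) — and abc-iut-L1-d7's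
`exists_transport_of_cor411iv` (`ArithmeticFrobenioidThm64ivTransport.lean`) turns it into the datum.  Results:
`Thm64iv_schema_arith` / `Thm64iv_schema_arith_of_baseIso` / `Thm64iv_degOne_schema_arith` / `Thm64iii_schema_arith` — the ∃-packaged forms of
`Thm64iv_arith_of_datum` / `…_of_baseIso` / `Thm64iv_degOne_of_datum` / `Thm64iii_arith_of_datum`, with no hypothesis
beyond the data (and `F₁` Galois over `ℚ`, resp. `φ : F₁ ≅ F₂`, for the compatibility clause of (iv) — row T64iv/L07b,
GAP-LEDGER G-L1t3-1 otherwise).  Nothing here bears on [IUTchIII] Cor. 3.12; no statement of the paper is strengthened.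
-/

noncomputable section

open scoped NNReal

namespace Literature.AlgebraicGeometry.Frobenioids

open CategoryTheory Opposite Function NumberField Literature.AnabelianGeometry.EtaleTheta

section Unconditional

variable {F₁ : Type} [Field F₁] [NumberField F₁] {K₁ : Type} [Field K₁] [Algebra F₁ K₁] [IsGalois F₁ K₁]
  {F₂ : Type} [Field F₂] [NumberField F₂] {K₂ : Type} [Field K₂] [Algebra F₂ K₂] [IsGalois F₂ K₂]
  (hΦ₁ : PreFrobenioid.IsPerfFactorialOn (arithDivisorFunctor F₁ K₁))
  (hΦ₂ : PreFrobenioid.IsPerfFactorialOn (arithDivisorFunctor F₂ K₂))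
  (Ψ : arithFrobenioid F₁ K₁ ≌ arithFrobenioid F₂ K₂)

/-- **[FrdI] Theorem 6.4 (iv) AS TYPED, AT THE CONSTRUCTIONS, for EVERY equivalence `Ψ : C_{K₁/F₁} ⥲ C_{K₂/F₂}`
(`F₁` Galois over `ℚ`).**  There are THE induced `Ψ^Base` (an equivalence under `Ψ`), `Ψ^rlf` (an equivalence over
`Ψ^Base`) and `picMap` (satisfying `Thm64ii`) such that `Thm64iv R₁ R₂ Ψrlf picMap deg M₁ M₂ r₁ r₂ Ψ Ψ^Base` holds for
every `deg` and all `r_i`. [cite: MochizukiFrdI2008, Thm. 6.4 (iv) p.115] -/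
theorem Thm64iv_schema_arith [IsGalois ℚ F₁] :
    ∃ (ΨBase : FinSubextCat F₁ K₁ ⥤ FinSubextCat F₂ K₂) (_ : ΨBase.IsEquivalence)
      (_ : Ψ.functor ⋙ (arithFrobenioidOps F₂ K₂).base ≅ (arithFrobenioidOps F₁ K₁).base ⋙ ΨBase)
      (Ψrlf : PreFrobenioid.rlf (ModelFrobenioid.toElem (arithDivisorFunctor F₁ K₁) (unitsFunctor F₁ K₁)
          (divNatTrans F₁ K₁)) hΦ₁ ≌
        PreFrobenioid.rlf (ModelFrobenioid.toElem (arithDivisorFunctor F₂ K₂) (unitsFunctor F₂ K₂)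
          (divNatTrans F₂ K₂)) hΦ₂)
      (picMap : ∀ A, (arithRealification hΦ₁).Pic A ≃+ (arithRealification hΦ₂).Pic (Ψrlf.functor.obj A)),
      Nonempty (Ψrlf.functor ⋙ (arithRealification hΦ₂).ops.base ≅ (arithRealification hΦ₁).ops.base ⋙ ΨBase) ∧
      Thm64ii (arithRealification hΦ₁) (arithRealification hΦ₂) Ψrlf picMap ∧
      ∀ (deg : ℝ)
        (r₁ : arithFrobenioid F₁ K₁ ⥤ PreFrobenioid.rlf (ModelFrobenioid.toElem (arithDivisorFunctor F₁ K₁)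
          (unitsFunctor F₁ K₁) (divNatTrans F₁ K₁)) hΦ₁)
        (r₂ : arithFrobenioid F₂ K₂ ⥤ PreFrobenioid.rlf (ModelFrobenioid.toElem (arithDivisorFunctor F₂ K₂)
          (unitsFunctor F₂ K₂) (divNatTrans F₂ K₂)) hΦ₂),
        Thm64iv (arithRealification hΦ₁) (arithRealification hΦ₂) Ψrlf picMap deg
          (arithModelFrobenioid F₁ K₁) (arithModelFrobenioid F₂ K₂) r₁ r₂ Ψ ΨBase := by
  obtain ⟨ΨBase, E, η, π, hEq, -, hπ, hdiv⟩ := exists_transport_of_cor411iv Ψ (cor411iv_arith Ψ)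
  haveI := hEq
  obtain ⟨Ψrlf, picMap, hη, hT, h⟩ := Thm64iv_arith_of_datum hΦ₁ hΦ₂ Ψ ΨBase E η hdiv π hπ
  exact ⟨ΨBase, hEq, η, Ψrlf, picMap, hη, hT, h⟩

/-- **The same with an explicit isomorphism `φ : F₁ ≅ F₂`** (row T64iv/L07b residual as an input; GAP G-L1t3-1).
[cite: MochizukiFrdI2008, Thm. 6.4 (iv) p.115] -/
theorem Thm64iv_schema_arith_of_baseIso (φ : F₁ ≃+* F₂) :
    ∃ (ΨBase : FinSubextCat F₁ K₁ ⥤ FinSubextCat F₂ K₂) (_ : ΨBase.IsEquivalence)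
      (_ : Ψ.functor ⋙ (arithFrobenioidOps F₂ K₂).base ≅ (arithFrobenioidOps F₁ K₁).base ⋙ ΨBase)
      (Ψrlf : PreFrobenioid.rlf (ModelFrobenioid.toElem (arithDivisorFunctor F₁ K₁) (unitsFunctor F₁ K₁)
          (divNatTrans F₁ K₁)) hΦ₁ ≌
        PreFrobenioid.rlf (ModelFrobenioid.toElem (arithDivisorFunctor F₂ K₂) (unitsFunctor F₂ K₂)
          (divNatTrans F₂ K₂)) hΦ₂)
      (picMap : ∀ A, (arithRealification hΦ₁).Pic A ≃+ (arithRealification hΦ₂).Pic (Ψrlf.functor.obj A)),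
      Nonempty (Ψrlf.functor ⋙ (arithRealification hΦ₂).ops.base ≅ (arithRealification hΦ₁).ops.base ⋙ ΨBase) ∧
      Thm64ii (arithRealification hΦ₁) (arithRealification hΦ₂) Ψrlf picMap ∧
      ∀ (deg : ℝ)
        (r₁ : arithFrobenioid F₁ K₁ ⥤ PreFrobenioid.rlf (ModelFrobenioid.toElem (arithDivisorFunctor F₁ K₁)
          (unitsFunctor F₁ K₁) (divNatTrans F₁ K₁)) hΦ₁)
        (r₂ : arithFrobenioid F₂ K₂ ⥤ PreFrobenioid.rlf (ModelFrobenioid.toElem (arithDivisorFunctor F₂ K₂)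
          (unitsFunctor F₂ K₂) (divNatTrans F₂ K₂)) hΦ₂),
        Thm64iv (arithRealification hΦ₁) (arithRealification hΦ₂) Ψrlf picMap deg
          (arithModelFrobenioid F₁ K₁) (arithModelFrobenioid F₂ K₂) r₁ r₂ Ψ ΨBase := by
  obtain ⟨ΨBase, E, η, π, hEq, -, hπ, hdiv⟩ := exists_transport_of_cor411iv Ψ (cor411iv_arith Ψ)
  haveI := hEq
  obtain ⟨Ψrlf, picMap, hη, hT, h⟩ := Thm64iv_arith_of_datum_of_baseIso hΦ₁ hΦ₂ Ψ ΨBase E η hdiv π hπ φ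
  exact ⟨ΨBase, hEq, η, Ψrlf, picMap, hη, hT, h⟩

/-- **"Then `deg(Ψ^rlf) = 1`" for every `Ψ`**, no hypothesis on `F₁`, `F₂`: THE induced `picMap` commutes with the
`δ`'s on the nose, and every `X` with `X.L` Galois over `ℚ` corresponds via `Ψ^Base` to an isomorphic field.
[cite: MochizukiFrdI2008, Thm. 6.4 (iv) p.115] -/
theorem Thm64iv_degOne_schema_arith :
    ∃ (ΨBase : FinSubextCat F₁ K₁ ⥤ FinSubextCat F₂ K₂) (_ : ΨBase.IsEquivalence)
      (_ : Ψ.functor ⋙ (arithFrobenioidOps F₂ K₂).base ≅ (arithFrobenioidOps F₁ K₁).base ⋙ ΨBase)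
      (Ψrlf : PreFrobenioid.rlf (ModelFrobenioid.toElem (arithDivisorFunctor F₁ K₁) (unitsFunctor F₁ K₁)
          (divNatTrans F₁ K₁)) hΦ₁ ≌
        PreFrobenioid.rlf (ModelFrobenioid.toElem (arithDivisorFunctor F₂ K₂) (unitsFunctor F₂ K₂)
          (divNatTrans F₂ K₂)) hΦ₂)
      (picMap : ∀ A, (arithRealification hΦ₁).Pic A ≃+ (arithRealification hΦ₂).Pic (Ψrlf.functor.obj A)),
      Nonempty (Ψrlf.functor ⋙ (arithRealification hΦ₂).ops.base ≅ (arithRealification hΦ₁).ops.base ⋙ ΨBase) ∧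
      Thm64iiDeg (arithRealification hΦ₁) (arithRealification hΦ₂) Ψrlf picMap 1 ∧
      ∀ X : FinSubextCat F₁ K₁, IsGalois ℚ X.L → Nonempty (X.L ≃+* (ΨBase.obj X).L) := by
  obtain ⟨ΨBase, E, η, π, hEq, -, hπ, hdiv⟩ := exists_transport_of_cor411iv Ψ (cor411iv_arith Ψ)
  haveI := hEq
  obtain ⟨Ψrlf, picMap, hη, h1, hiso⟩ := Thm64iv_degOne_of_datum hΦ₁ hΦ₂ Ψ ΨBase E η hdiv π hπ
  exact ⟨ΨBase, hEq, η, Ψrlf, picMap, hη, h1, hiso⟩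

/-- **[FrdI] Theorem 6.4 (iii) AS TYPED, AT THE CONSTRUCTIONS, in the (iv)-situation, for EVERY `Ψ`** (the
∃-packaged `Thm64iii_arith_of_datum`; the general `(Ψ^pf)^un-tr` case of print's (iii) is not claimed).
[cite: MochizukiFrdI2008, Thm. 6.4 (iii) p.114] -/
theorem Thm64iii_schema_arith :
    ∃ (ΨBase : FinSubextCat F₁ K₁ ⥤ FinSubextCat F₂ K₂) (_ : ΨBase.IsEquivalence)
      (_ : Ψ.functor ⋙ (arithFrobenioidOps F₂ K₂).base ≅ (arithFrobenioidOps F₁ K₁).base ⋙ ΨBase)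
      (Ψrlf : PreFrobenioid.rlf (ModelFrobenioid.toElem (arithDivisorFunctor F₁ K₁) (unitsFunctor F₁ K₁)
          (divNatTrans F₁ K₁)) hΦ₁ ≌
        PreFrobenioid.rlf (ModelFrobenioid.toElem (arithDivisorFunctor F₂ K₂) (unitsFunctor F₂ K₂)
          (divNatTrans F₂ K₂)) hΦ₂)
      (picMap : ∀ A, (arithRealification hΦ₁).Pic A ≃+ (arithRealification hΦ₂).Pic (Ψrlf.functor.obj A)),
      (∀ A, (arithRealification hΦ₂).ops.base.obj (Ψrlf.functor.obj A) =
        ΨBase.obj ((arithRealification hΦ₁).ops.base.obj A)) ∧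
      Thm64ii (arithRealification hΦ₁) (arithRealification hΦ₂) Ψrlf picMap ∧
      ∀ X : FinSubextCat F₁ K₁,
        ∃ placeMap : Places ((arithRealification hΦ₁).ops.base.obj
              (⟨X, 1⟩ : PreFrobenioid.rlf (ModelFrobenioid.toElem (arithDivisorFunctor F₁ K₁) (unitsFunctor F₁ K₁)
                (divNatTrans F₁ K₁)) hΦ₁)).L ≃
            Places ((arithRealification hΦ₂).ops.base.obj (Ψrlf.functor.obj ⟨X, 1⟩)).L,
          ∀ deg : ℝ,
            Thm64iii (arithRealification hΦ₁) (arithRealification hΦ₂) Ψrlf picMap deg (𝟭 _) (𝟭 _) Ψrlf ⟨X, 1⟩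
              placeMap := by
  obtain ⟨ΨBase, E, η, π, hEq, -, -, hdiv⟩ := exists_transport_of_cor411iv Ψ (cor411iv_arith Ψ)
  haveI := hEq
  obtain ⟨Ψrlf, picMap, hbase, hT, h⟩ := Thm64iii_arith_of_datum hΦ₁ hΦ₂ Ψ ΨBase E η hdiv
  exact ⟨ΨBase, hEq, η, Ψrlf, picMap, hbase, hT, h⟩

end Unconditional

end Literature.AlgebraicGeometry.Frobenioids

end
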